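import Summits.HodgeConjecture.HodgeConjecture.Theorems.F0P3cStCharTSHCDescentSemisimpleSliceK  -- (this seat) file C₁: `e_K`, Newton data, descent algebra, carriers
import Summits.HodgeConjecture.HodgeConjecture.Theorems.F0P3cStCharTSNewtonCore                 -- ★ p852029 (F0P2-p01) FILE 2′: `depth_chart_of_newtonData`
import HarnessLib

/-!
# F0 · P3c · line LH6 «StCharTS» — ROAD «HC-D», brick (D5ii) «SEMISIMPLE DESCENT AT TYPE (a,a,b)», file C₂ (SLICE CHART): on small boxes the slice map
# `Ψ(Y, Z) = c(Y)(S₀ + Z)c(Y)⁻¹ : (𝔲 ∩ 𝔪) × (𝔲 ∩ 𝔠) → 𝔲` IS its linearisation `e (Y, Z) = 2[S₀, Y] + Z` — exact box images and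
# `∫_{Λ_k} f(Ψ v) dμ = ∫_{Λ_k} f(S₀ + e v) dμ`

Cell `pub/hodgecm-mathlib`, crux H413 = `stmt-HodgeConjecture-24833` (lane `--supports … --as helper`), route HCCMUnconditional; seat F0P3a-p05 (g23), brick (D4e)+(D5ii)
of F0P2-p01 (g23)'s road «HC-D» (census `F0/P2/p01/g23/CENSUS-HCD.v1.F0P2p01g23.md` §1 (ii); dealt 2026-09-02T16:11:14Z; WORDS #3 16:21:56Z).
THEOREMS ONLY (no definition ∕ instance ∕ notation ∕ named fact ∕ `sorry`); imports (this seat) file C₁ + ★ FILE 2′.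
HONEST LABEL: HC_CM is proved only modulo the 7 printed citations (2 remaining: hLiu418 = `stmt-HodgeConjecture-24832`, h413 = `stmt-HodgeConjecture-24833`)
until rung 0 closes; count-neutral analysis for the named input (HC-D) «`|D_G|^{−1∕2} ∈ L¹_loc(G)`» [HarishChandra1970, Part VII §1 Thm. 15] of the (S-𝔇) organ; closes no organ.

THE MATHEMATICS ([HarishChandra1970, Part VI Lemma 22, Part VII §1]; the `p`-adic inverse function theorem [Schikhof1984, §27]; [Serre1992LALG, Part II Ch. IV §9]).
`K` complete ultrametric nontrivially normed, proper, second countable, perfect of characteristic `0`; `σ` continuous, `J` with unit determinant, `𝔲` the `F`-submodule of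
skew matrices (field hypothesis), `S₀ ∈ 𝔲` annihilated by a separable polynomial; `𝔪 = 𝔲 ⊓ range (ad S₀)`, `𝔠 = 𝔲 ⊓ ker (ad S₀)` (subtypes of `M_n(K)`, elementwise norms).
DESCENT (the argument of ★ FILE 2′ `newtonData_addSubgroup`, run on product carriers): the ambient Newton datum `z ∈ 𝔪_K × 𝔠_K` (file C₁ `exists_newtonData_K`) with
`e_K z = Ψ(x+y) − Ψ(x) − e_K y` for `x, y ∈ 𝔪 × 𝔠` has `e_K z ∈ 𝔲` (file C₁ `slice_sub_mem`), hence `z ∈ 𝔪 × 𝔠` with the same norm, because `e_K` restricts to the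
isomorphism `e : 𝔪 × 𝔠 ≃ 𝔲` of ★ file A `exists_sliceLinearEquiv` (here upgraded to `≃ₜ+`: it is the restriction of the homeomorphism `e_K`).  Then ★ FILE 2′
`depth_chart_of_newtonData` on `V = 𝔪 × 𝔠` (ultrametric, proper — file C₁) with ANY left-invariant Borel `μ` finite on compacts and `W = 𝔲` gives
**`exists_slice_chart`**: `∃ e k₀, (∀ q, ↑(e q) = 2(S₀q₁ − q₁S₀) + q₂) ∧ ∀ k ≥ k₀`, `Ψ` is injective on `Λ_k = closedBall 0 (rγᵏ)`, `Ψ(Λ_k) = S₀ + e(Λ_k)` EXACTLY, and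
`∫⁻ v in Λ_k, f (Ψ v) ∂μ = ∫⁻ v in Λ_k, f (S₀ + e v) ∂μ` for every measurable `f : M_n(K) → ℝ≥0∞`.  With file C₁ `charpoly_slice_eq` every conjugation-invariant
integrand (the road's `|η|^{−s}`, `η = disc ∘ charpoly`) reads `f(S₀ + Z)` on the box; file D Fubinis `Λ_k = ball_𝔪 × ball_𝔠`, transports `(μ|Λ_k).map e` to the Haar
measure of `𝔲`, and docks the `𝔠`-integral on D3b in normal form (★ file A §2).

## References
* [HarishChandra1970] Harish-Chandra (notes by G. van Dijk), *Harmonic Analysis on Reductive p-adic Groups*, LNM 162 (1970), Part VI Lemma 22; Part VII §1 Thm. 15.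
* [Schikhof1984] W. H. Schikhof, *Ultrametric Calculus*, Cambridge (1984), §27 Lemma 27.4–Thm. 27.5.
* [Serre1992LALG] J.-P. Serre, *Lie Algebras and Lie Groups*, LNM 1500 (1992), Part II Ch. IV §9.
* [Rogawski1990] J. D. Rogawski, *Automorphic Representations of Unitary Groups in Three Variables*, Ann. of Math. Stud. 123 (1990), §8.2 Prop. 8.2.1 p. 112; §12.5 p. 182.
-/

set_option autoImplicit false
-- the mandated namespace has the single-problem summit's repeated segment (`HodgeConjecture.HodgeConjecture`)
set_option linter.dupNamespace false

noncomputable section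

open MeasureTheory Filter Metric Set Polynomial
open scoped Matrix Matrix.Norms.Elementwise Topology ENNReal Pointwise
open Literature.Analysis.Calculus Literature.Analysis.Matrix Literature.LinearAlgebra.Matrix Literature.NumberTheory.Automorphic
open Summit.HodgeConjecture.HodgeConjecture.Cruxes.H413.F0P3cStCharTSHCDescentSemisimpleAlg
open Summit.HodgeConjecture.HodgeConjecture.Cruxes.H413.F0P3cStCharTSNewtonCore
open Summit.HodgeConjecture.HodgeConjecture.Cruxes.H413.F0P3cStCharTSCartanDecompositionSkew

open Summit.HodgeConjecture.HodgeConjecture.Cruxes.H413.F0P3cStCharTSHCDescentSemisimpleSliceK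

namespace Summit.HodgeConjecture.HodgeConjecture.Cruxes.H413.F0P3cStCharTSHCDescentSemisimpleSlice

/-! ## The slice chart on the `F`-Lie algebra: exact box images and the change-of-variables identity -/

section Chart

variable {K : Type*} [NontriviallyNormedField K] [IsUltrametricDist K] [CompleteSpace K] {n : Type*} [Fintype n] [DecidableEq n]
  (σ : K →+* K) (J : Matrix n n K)

set_option maxHeartbeats 800000 in
-- the carriers are long subtype-product types; instance unification across the `Matrix`/`Pi`/`Submodule` topologies is the cost
/-- **THE SLICE CHART ON THE `F`-LIE ALGEBRA.**  `K` a complete ultrametric nontrivially normed field, proper and second countable, perfect of characteristic `0`;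
`σ` continuous, `J` with unit determinant, `𝔲` the `F`-submodule of skew matrices (field hypothesis), `S₀ ∈ 𝔲` annihilated by a separable polynomial;
`𝔪 = 𝔲 ⊓ range (ad S₀)`, `𝔠 = 𝔲 ⊓ ker (ad S₀)`; `μ` ANY left-invariant Borel measure on `𝔪 × 𝔠` finite on compacts; `Λ j = closedBall 0 (rγʲ)` (sup of the elementwise norms).
Then there are a topological additive isomorphism `e : 𝔪 × 𝔠 ≃ₜ+ 𝔲` with `e (Y, Z) = 2(S₀Y − YS₀) + Z` and a depth `k₀` such that for all `k ≥ k₀` the slice map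
`Ψ(Y, Z) = c(Y)(S₀ + Z)c(Y)⁻¹` is injective on `Λ k`, maps it EXACTLY onto `S₀ + e(Λ k)`, and `∫⁻ v in Λ k, f (Ψ v) ∂μ = ∫⁻ v in Λ k, f (S₀ + e v) ∂μ` for every measurable
`f : M_n(K) → ℝ≥0∞` (★ FILE 2′ `depth_chart_of_newtonData` on the Newton data of §1 descended as in §2). [cite: HarishChandra1970, Part VI Lemma 22; Part VII §1 Thm. 15]
[cite: Schikhof1984, §27 Lemma 27.4–Thm. 27.5] [cite: Serre1992LALG, Part II Ch. IV §9] -/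
theorem exists_slice_chart [PerfectField K] [CharZero K] [ProperSpace K] [SecondCountableTopology K]
    [MeasurableSpace (Matrix n n K)] [BorelSpace (Matrix n n K)]
    {F : Type*} [Field F] [Algebra F K] (hJ : IsUnit J.det)
    (hσ : Continuous σ) (𝔲 : Submodule F (Matrix n n K)) (h𝔲 : ∀ X : Matrix n n K, X ∈ 𝔲 ↔ (X.map σ)ᵀ * J + J * X = 0)
    {S₀ : Matrix n n K} (hS : (S₀.map σ)ᵀ * J + J * S₀ = 0) {p : K[X]} (hp : p.Separable) (hpS : aeval S₀ p = 0)
    (μ : Measure (↥(𝔲 ⊓ (LinearMap.range (LinearMap.mulLeft K S₀ - LinearMap.mulRight K S₀ : Module.End K (Matrix n n K))).restrictScalars F) ×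
      ↥(𝔲 ⊓ (LinearMap.ker (LinearMap.mulLeft K S₀ - LinearMap.mulRight K S₀ : Module.End K (Matrix n n K))).restrictScalars F)))
    [IsFiniteMeasureOnCompacts μ] [μ.IsAddLeftInvariant]
    {Λ : ℕ → AddSubgroup (↥(𝔲 ⊓ (LinearMap.range (LinearMap.mulLeft K S₀ - LinearMap.mulRight K S₀ : Module.End K (Matrix n n K))).restrictScalars F) ×
      ↥(𝔲 ⊓ (LinearMap.ker (LinearMap.mulLeft K S₀ - LinearMap.mulRight K S₀ : Module.End K (Matrix n n K))).restrictScalars F))}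
    {r γ : ℝ}
    (hΛ : ∀ j, (Λ j : Set (↥(𝔲 ⊓ (LinearMap.range (LinearMap.mulLeft K S₀ - LinearMap.mulRight K S₀ : Module.End K (Matrix n n K))).restrictScalars F) ×
      ↥(𝔲 ⊓ (LinearMap.ker (LinearMap.mulLeft K S₀ - LinearMap.mulRight K S₀ : Module.End K (Matrix n n K))).restrictScalars F))) = closedBall 0 (r * γ ^ j))
    (hr : 0 < r) (hγ0 : 0 < γ) (hγ1 : γ < 1) :
    ∃ (e : (↥(𝔲 ⊓ (LinearMap.range (LinearMap.mulLeft K S₀ - LinearMap.mulRight K S₀ : Module.End K (Matrix n n K))).restrictScalars F) ×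
              ↥(𝔲 ⊓ (LinearMap.ker (LinearMap.mulLeft K S₀ - LinearMap.mulRight K S₀ : Module.End K (Matrix n n K))).restrictScalars F)) ≃ₜ+ ↥𝔲)
      (k₀ : ℕ),
      (∀ q, ((e q : ↥𝔲) : Matrix n n K) = (2 : K) • (S₀ * (q.1 : Matrix n n K) - (q.1 : Matrix n n K) * S₀) + (q.2 : Matrix n n K)) ∧
      ∀ k, k₀ ≤ k →
        InjOn (fun q : ↥(𝔲 ⊓ (LinearMap.range (LinearMap.mulLeft K S₀ - LinearMap.mulRight K S₀ : Module.End K (Matrix n n K))).restrictScalars F) ×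
              ↥(𝔲 ⊓ (LinearMap.ker (LinearMap.mulLeft K S₀ - LinearMap.mulRight K S₀ : Module.End K (Matrix n n K))).restrictScalars F) =>
            cayley (q.1 : Matrix n n K) * (S₀ + (q.2 : Matrix n n K)) * Ring.inverse (cayley (q.1 : Matrix n n K))) (Λ k) ∧
        (fun q : ↥(𝔲 ⊓ (LinearMap.range (LinearMap.mulLeft K S₀ - LinearMap.mulRight K S₀ : Module.End K (Matrix n n K))).restrictScalars F) ×
              ↥(𝔲 ⊓ (LinearMap.ker (LinearMap.mulLeft K S₀ - LinearMap.mulRight K S₀ : Module.End K (Matrix n n K))).restrictScalars F) =>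
            cayley (q.1 : Matrix n n K) * (S₀ + (q.2 : Matrix n n K)) * Ring.inverse (cayley (q.1 : Matrix n n K))) '' (Λ k : Set _) =
          (fun q => S₀ + ((e q : ↥𝔲) : Matrix n n K)) '' (Λ k : Set _) ∧
        ∀ f : Matrix n n K → ℝ≥0∞, Measurable f →
          ∫⁻ v in (Λ k : Set _), f (cayley (v.1 : Matrix n n K) * (S₀ + (v.2 : Matrix n n K)) * Ring.inverse (cayley (v.1 : Matrix n n K))) ∂μ =
            ∫⁻ v in (Λ k : Set _), f (S₀ + ((e v : ↥𝔲) : Matrix n n K)) ∂μ := by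
  -- ambient instances on `M_n(K)` and the subspaces
  haveI : IsUltrametricDist (Matrix n n K) := isUltrametricDist_matrix
  haveI : SecondCountableTopology (Matrix n n K) := inferInstanceAs (SecondCountableTopology (n → n → K))
  haveI hU𝔪 := isUltrametricDist_submodule (𝔲 ⊓ (LinearMap.range (LinearMap.mulLeft K S₀ - LinearMap.mulRight K S₀ : Module.End K (Matrix n n K))).restrictScalars F)
  haveI hU𝔠 := isUltrametricDist_submodule (𝔲 ⊓ (LinearMap.ker (LinearMap.mulLeft K S₀ - LinearMap.mulRight K S₀ : Module.End K (Matrix n n K))).restrictScalars F)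
  haveI : IsUltrametricDist (↥(𝔲 ⊓ (LinearMap.range (LinearMap.mulLeft K S₀ - LinearMap.mulRight K S₀ : Module.End K (Matrix n n K))).restrictScalars F) ×
      ↥(𝔲 ⊓ (LinearMap.ker (LinearMap.mulLeft K S₀ - LinearMap.mulRight K S₀ : Module.End K (Matrix n n K))).restrictScalars F)) := isUltrametricDist_prod
  -- closedness ⇒ properness of the subspaces
  have h𝔲cl : IsClosed (𝔲 : Set (Matrix n n K)) := by
    have : (𝔲 : Set (Matrix n n K)) = {X : Matrix n n K | (X.map σ)ᵀ * J + J * X = 0} := Set.ext fun X => by simpa using h𝔲 X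
    rw [this]; exact isClosed_skew σ J hσ
  have h𝔪cl : IsClosed ((𝔲 ⊓ (LinearMap.range (LinearMap.mulLeft K S₀ - LinearMap.mulRight K S₀ : Module.End K (Matrix n n K))).restrictScalars F :
      Submodule F (Matrix n n K)) : Set (Matrix n n K)) := by
    rw [Submodule.coe_inf]
    exact h𝔲cl.inter (Submodule.closed_of_finiteDimensional _)
  have h𝔠cl : IsClosed ((𝔲 ⊓ (LinearMap.ker (LinearMap.mulLeft K S₀ - LinearMap.mulRight K S₀ : Module.End K (Matrix n n K))).restrictScalars F :
      Submodule F (Matrix n n K)) : Set (Matrix n n K)) := by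
    rw [Submodule.coe_inf]
    exact h𝔲cl.inter (Submodule.closed_of_finiteDimensional _)
  haveI : ProperSpace ↥(𝔲 ⊓ (LinearMap.range (LinearMap.mulLeft K S₀ - LinearMap.mulRight K S₀ : Module.End K (Matrix n n K))).restrictScalars F) :=
    properSpace_subtype_of_isClosed h𝔪cl
  haveI : ProperSpace ↥(𝔲 ⊓ (LinearMap.ker (LinearMap.mulLeft K S₀ - LinearMap.mulRight K S₀ : Module.End K (Matrix n n K))).restrictScalars F) :=
    properSpace_subtype_of_isClosed h𝔠cl
  -- the two linear parts: `eK` over `K` on `𝔪_K × 𝔠_K`, `eF` over `F` on `𝔪 × 𝔠`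
  obtain ⟨eK, heK⟩ := exists_sliceLinearEquivK (n := n) hp hpS
  obtain ⟨eF, heF⟩ := exists_sliceLinearEquiv σ J hJ 𝔲 h𝔲 hS hp hpS
  -- the inclusion `ι : 𝔪 × 𝔠 → 𝔪_K × 𝔠_K`
  obtain ⟨ι, hιdef⟩ : ∃ ι : (↥(𝔲 ⊓ (LinearMap.range (LinearMap.mulLeft K S₀ - LinearMap.mulRight K S₀ : Module.End K (Matrix n n K))).restrictScalars F) ×
        ↥(𝔲 ⊓ (LinearMap.ker (LinearMap.mulLeft K S₀ - LinearMap.mulRight K S₀ : Module.End K (Matrix n n K))).restrictScalars F)) →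
      (↥(LinearMap.range (LinearMap.mulLeft K S₀ - LinearMap.mulRight K S₀ : Module.End K (Matrix n n K))) ×
        ↥(LinearMap.ker (LinearMap.mulLeft K S₀ - LinearMap.mulRight K S₀ : Module.End K (Matrix n n K)))),
      ι = fun q => (⟨(q.1 : Matrix n n K), (Submodule.mem_inf.1 q.1.2).2⟩, ⟨(q.2 : Matrix n n K), (Submodule.mem_inf.1 q.2.2).2⟩) := ⟨_, rfl⟩
  have hι1 : ∀ q, ((ι q).1 : Matrix n n K) = (q.1 : Matrix n n K) := fun q => by rw [hιdef]
  have hι2 : ∀ q, ((ι q).2 : Matrix n n K) = (q.2 : Matrix n n K) := fun q => by rw [hιdef]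
  have hιadd : ∀ q q', ι (q + q') = ι q + ι q' := fun q q' => by
    subst hιdef; rfl
  have hιnorm : ∀ q, ‖ι q‖ = ‖q‖ := fun q => by
    subst hιdef; rfl
  have hιe : ∀ q, eK (ι q) = ((eF q : ↥𝔲) : Matrix n n K) := fun q => by rw [heK, heF, hι1, hι2]
  have hιsymm : ∀ X : ↥𝔲, ι (eF.symm X) = eK.symm (X : Matrix n n K) := fun X => by
    apply eK.injective
    rw [hιe, LinearEquiv.apply_symm_apply, ContinuousLinearEquiv.apply_symm_apply]
  -- `eF` as a topological additive isomorphism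
  have hcont : Continuous eF := by
    have h1 : Continuous fun q : ↥(𝔲 ⊓ (LinearMap.range (LinearMap.mulLeft K S₀ - LinearMap.mulRight K S₀ : Module.End K (Matrix n n K))).restrictScalars F) ×
        ↥(𝔲 ⊓ (LinearMap.ker (LinearMap.mulLeft K S₀ - LinearMap.mulRight K S₀ : Module.End K (Matrix n n K))).restrictScalars F) => ((eF q : ↥𝔲) : Matrix n n K) := by
      have : (fun q : ↥(𝔲 ⊓ (LinearMap.range (LinearMap.mulLeft K S₀ - LinearMap.mulRight K S₀ : Module.End K (Matrix n n K))).restrictScalars F) ×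
          ↥(𝔲 ⊓ (LinearMap.ker (LinearMap.mulLeft K S₀ - LinearMap.mulRight K S₀ : Module.End K (Matrix n n K))).restrictScalars F) => ((eF q : ↥𝔲) : Matrix n n K)) =
          fun q => eK (ι q) := funext fun q => (hιe q).symm
      rw [this]
      have hιcont : Continuous ι := by
        rw [hιdef]
        exact ((continuous_subtype_val.comp continuous_fst).subtype_mk _).prodMk ((continuous_subtype_val.comp continuous_snd).subtype_mk _)
      exact eK.continuous.comp hιcont
    exact h1.subtype_mk _
  have hcont' : Continuous eF.symm := by
    have h1 : Continuous fun X : ↥𝔲 => (((eF.symm X).1 : Matrix n n K), ((eF.symm X).2 : Matrix n n K)) := by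
      have : (fun X : ↥𝔲 => (((eF.symm X).1 : Matrix n n K), ((eF.symm X).2 : Matrix n n K))) =
          fun X : ↥𝔲 => ((((eK.symm (X : Matrix n n K)).1) : Matrix n n K), (((eK.symm (X : Matrix n n K)).2) : Matrix n n K)) := by
        funext X
        rw [← hι1, ← hι2, hιsymm]
      rw [this]
      exact ((continuous_subtype_val.comp continuous_fst).prodMk (continuous_subtype_val.comp continuous_snd)).comp
        (eK.symm.continuous.comp continuous_subtype_val)
    exact ((continuous_fst.comp h1).subtype_mk _).prodMk ((continuous_snd.comp h1).subtype_mk _)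
  obtain ⟨e, he⟩ : ∃ e : (↥(𝔲 ⊓ (LinearMap.range (LinearMap.mulLeft K S₀ - LinearMap.mulRight K S₀ : Module.End K (Matrix n n K))).restrictScalars F) ×
        ↥(𝔲 ⊓ (LinearMap.ker (LinearMap.mulLeft K S₀ - LinearMap.mulRight K S₀ : Module.End K (Matrix n n K))).restrictScalars F)) ≃ₜ+ ↥𝔲, ∀ q, e q = eF q :=
    ⟨{ eF.toAddEquiv with continuous_toFun := hcont, continuous_invFun := hcont' }, fun q => rfl⟩
  -- the slice map into `𝔲` (total), base point `0`
  have hmem : ∀ q : ↥(𝔲 ⊓ (LinearMap.range (LinearMap.mulLeft K S₀ - LinearMap.mulRight K S₀ : Module.End K (Matrix n n K))).restrictScalars F) ×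
        ↥(𝔲 ⊓ (LinearMap.ker (LinearMap.mulLeft K S₀ - LinearMap.mulRight K S₀ : Module.End K (Matrix n n K))).restrictScalars F),
      cayley (q.1 : Matrix n n K) * (S₀ + (q.2 : Matrix n n K)) * Ring.inverse (cayley (q.1 : Matrix n n K)) - S₀ ∈ 𝔲 := fun q =>
    (h𝔲 _).2 (slice_sub_mem σ J hJ hS ((h𝔲 _).1 (Submodule.mem_inf.1 q.1.2).1) ((h𝔲 _).1 (Submodule.mem_inf.1 q.2.2).1))
  obtain ⟨φ, hφdef⟩ : ∃ φ : (↥(𝔲 ⊓ (LinearMap.range (LinearMap.mulLeft K S₀ - LinearMap.mulRight K S₀ : Module.End K (Matrix n n K))).restrictScalars F) ×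
        ↥(𝔲 ⊓ (LinearMap.ker (LinearMap.mulLeft K S₀ - LinearMap.mulRight K S₀ : Module.End K (Matrix n n K))).restrictScalars F)) → ↥𝔲,
      φ = fun q => ⟨cayley (q.1 : Matrix n n K) * (S₀ + (q.2 : Matrix n n K)) * Ring.inverse (cayley (q.1 : Matrix n n K)) - S₀, hmem q⟩ := ⟨_, rfl⟩
  have hφval : ∀ q, ((φ q : ↥𝔲) : Matrix n n K) = cayley (q.1 : Matrix n n K) * (S₀ + (q.2 : Matrix n n K)) * Ring.inverse (cayley (q.1 : Matrix n n K)) - S₀ :=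
    fun q => by rw [hφdef]
  have hφ0 : φ 0 = 0 := by
    apply Subtype.ext
    rw [hφval]
    simp [cayley_zero]
  -- Newton data on `𝔪 × 𝔠`, descended from §1
  obtain ⟨k₀, hNK⟩ := exists_newtonData_K S₀ eK heK hr hγ0 hγ1
  have hNP : ∀ k, k₀ ≤ k → ∀ j, k ≤ j →
      ∀ x ∈ closedBall (0 : ↥(𝔲 ⊓ (LinearMap.range (LinearMap.mulLeft K S₀ - LinearMap.mulRight K S₀ : Module.End K (Matrix n n K))).restrictScalars F) ×
          ↥(𝔲 ⊓ (LinearMap.ker (LinearMap.mulLeft K S₀ - LinearMap.mulRight K S₀ : Module.End K (Matrix n n K))).restrictScalars F)) (r * γ ^ k),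
      ∀ y ∈ closedBall (0 : ↥(𝔲 ⊓ (LinearMap.range (LinearMap.mulLeft K S₀ - LinearMap.mulRight K S₀ : Module.End K (Matrix n n K))).restrictScalars F) ×
          ↥(𝔲 ⊓ (LinearMap.ker (LinearMap.mulLeft K S₀ - LinearMap.mulRight K S₀ : Module.End K (Matrix n n K))).restrictScalars F)) (r * γ ^ j),
        φ (0 + (x + y)) - φ (0 + x) - e y ∈ (e : _ → ↥𝔲) '' closedBall 0 (r * γ ^ (j + 1)) := by
    intro k hk j hj x hx y hy
    have hx' : ι x ∈ closedBall (0 : ↥(LinearMap.range (LinearMap.mulLeft K S₀ - LinearMap.mulRight K S₀ : Module.End K (Matrix n n K))) ×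
        ↥(LinearMap.ker (LinearMap.mulLeft K S₀ - LinearMap.mulRight K S₀ : Module.End K (Matrix n n K)))) (r * γ ^ k) := by
      rw [mem_closedBall_zero_iff] at hx ⊢; rwa [hιnorm]
    have hy' : ι y ∈ closedBall (0 : ↥(LinearMap.range (LinearMap.mulLeft K S₀ - LinearMap.mulRight K S₀ : Module.End K (Matrix n n K))) ×
        ↥(LinearMap.ker (LinearMap.mulLeft K S₀ - LinearMap.mulRight K S₀ : Module.End K (Matrix n n K)))) (r * γ ^ j) := by
      rw [mem_closedBall_zero_iff] at hy ⊢; rwa [hιnorm]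
    obtain ⟨z, hz, hzeq⟩ := hNK k hk j hj (ι x) hx' (ι y) hy'
    -- `eK z` is the coercion of `φ (x+y) − φ x − e y ∈ 𝔲`
    have hval : eK z = ((φ (0 + (x + y)) - φ (0 + x) - e y : ↥𝔲) : Matrix n n K) := by
      rw [hzeq]
      simp only [zero_add, Submodule.coe_sub, hφval, he, ← hιe, hι1, hι2, Prod.fst_add, Prod.snd_add, Submodule.coe_add]
      abel
    have hzu : eK z ∈ 𝔲 := by rw [hval]; exact Subtype.mem _
    refine ⟨eF.symm ⟨eK z, hzu⟩, ?_, ?_⟩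
    · rw [mem_closedBall_zero_iff] at hz ⊢
      rw [← hιnorm, hιsymm, Submodule.coe_mk, ContinuousLinearEquiv.symm_apply_apply]
      exact hz
    · apply Subtype.ext
      rw [he, LinearEquiv.apply_symm_apply]
      exact hval
  -- ★ FILE 2′
  haveI : SecondCountableTopology ↥(𝔲 ⊓ (LinearMap.range (LinearMap.mulLeft K S₀ - LinearMap.mulRight K S₀ : Module.End K (Matrix n n K))).restrictScalars F) :=
    TopologicalSpace.Subtype.secondCountableTopology _
  haveI : SecondCountableTopology ↥(𝔲 ⊓ (LinearMap.ker (LinearMap.mulLeft K S₀ - LinearMap.mulRight K S₀ : Module.End K (Matrix n n K))).restrictScalars F) :=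
    TopologicalSpace.Subtype.secondCountableTopology _
  haveI hB : BorelSpace (↥(𝔲 ⊓ (LinearMap.range (LinearMap.mulLeft K S₀ - LinearMap.mulRight K S₀ : Module.End K (Matrix n n K))).restrictScalars F) ×
      ↥(𝔲 ⊓ (LinearMap.ker (LinearMap.mulLeft K S₀ - LinearMap.mulRight K S₀ : Module.End K (Matrix n n K))).restrictScalars F)) := Prod.borelSpace
  haveI hBu : BorelSpace ↥𝔲 := Subtype.borelSpace _
  have hchart := @depth_chart_of_newtonData _ _ _ _ _ hB _ _ _ hBu μ ‹IsFiniteMeasureOnCompacts μ› _ φ 0 e Λ r γ hΛ hr hγ0 hγ1 k₀ hNP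
  refine ⟨e, k₀, fun q => by rw [he, heF], fun k hk => ?_⟩
  obtain ⟨hinj, himg, -, hlin⟩ := hchart k hk
  refine ⟨?_, ?_, ?_⟩
  · -- injectivity
    rw [zero_vadd] at hinj
    intro v hv w hw hvw
    have h1 : φ v = φ w := Subtype.ext (by rw [hφval, hφval]; exact congrArg (· - S₀) hvw)
    exact hinj hv hw h1
  · -- exact image
    have himg0 := himg k le_rfl 0 (zero_mem _)
    rw [add_zero, zero_vadd, hφ0, zero_vadd] at himg0
    have hΨ : ∀ q, cayley (q.1 : Matrix n n K) * (S₀ + (q.2 : Matrix n n K)) * Ring.inverse (cayley (q.1 : Matrix n n K)) = S₀ + ((φ q : ↥𝔲) : Matrix n n K) :=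
      fun q => by rw [hφval, add_sub_cancel]
    have hΨφ : (fun q : ↥(𝔲 ⊓ (LinearMap.range (LinearMap.mulLeft K S₀ - LinearMap.mulRight K S₀ : Module.End K (Matrix n n K))).restrictScalars F) ×
              ↥(𝔲 ⊓ (LinearMap.ker (LinearMap.mulLeft K S₀ - LinearMap.mulRight K S₀ : Module.End K (Matrix n n K))).restrictScalars F) =>
            cayley (q.1 : Matrix n n K) * (S₀ + (q.2 : Matrix n n K)) * Ring.inverse (cayley (q.1 : Matrix n n K))) =
        (fun X : ↥𝔲 => S₀ + (X : Matrix n n K)) ∘ φ := funext fun q => hΨ q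
    have heS : (fun q : ↥(𝔲 ⊓ (LinearMap.range (LinearMap.mulLeft K S₀ - LinearMap.mulRight K S₀ : Module.End K (Matrix n n K))).restrictScalars F) ×
              ↥(𝔲 ⊓ (LinearMap.ker (LinearMap.mulLeft K S₀ - LinearMap.mulRight K S₀ : Module.End K (Matrix n n K))).restrictScalars F) =>
            S₀ + ((e q : ↥𝔲) : Matrix n n K)) =
        (fun X : ↥𝔲 => S₀ + (X : Matrix n n K)) ∘ (e : _ → ↥𝔲) := rfl
    rw [hΨφ, heS, Set.image_comp, Set.image_comp]
    exact congrArg (Set.image fun X : ↥𝔲 => S₀ + (X : Matrix n n K)) himg0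
  · -- change of variables
    intro f hf
    have hmeas : Measurable fun X : ↥𝔲 => f (S₀ + (X : Matrix n n K)) :=
      hf.comp ((continuous_const.add continuous_subtype_val).measurable)
    have h := hlin (fun X : ↥𝔲 => f (S₀ + (X : Matrix n n K))) hmeas
    simp only [zero_add, hφ0] at h
    have hΨ : ∀ q, S₀ + ((φ q : ↥𝔲) : Matrix n n K) = cayley (q.1 : Matrix n n K) * (S₀ + (q.2 : Matrix n n K)) * Ring.inverse (cayley (q.1 : Matrix n n K)) :=
      fun q => by rw [hφval, add_sub_cancel]
    simp only [hΨ] at h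
    exact h

end Chart

end Summit.HodgeConjecture.HodgeConjecture.Cruxes.H413.F0P3cStCharTSHCDescentSemisimpleSlice

end
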